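import Mathlib
import Literature.Topology.FourManifolds.PlanarAchiralWords
import Literature.Topology.FourManifolds.BalancedPresentation
import Summits.SmoothPoincare4.SmoothPoincare4.Theorems.ConvexBisectionPlanarAcyclicBisectionRigidityStubWalkLow
import HarnessLib

/-!
# Crux `ConvexBisection.PlanarAcyclicBisectionRigidity`, line Sketch (skeleton v2.0) — helpers
# `helper_monodromyU_mem` and `helper_seamTrivial_normallyGenerates`

Pure algebra on the definitions of `Literature/Topology/FourManifolds/PlanarAchiralWords.lean`
(arc data `ArcData n` of `Mod(D_n, ∂)`, `evalWord`, `monodromy`, `PlanarCurve.cls`, `SeamTrivial`,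
`NormallyGenerates`), reusing the `ArcData` monoid laws of the landed stub file `…StubWalkLow`
(sub-namespace `WalkLow`: `mul_u`, `aut_of`, `mul_assoc'`, `evalWord_append`, `invWord_cons`, …).

* `helper_monodromyU_mem`: the arc words `u₀(φ_A), …, u_{n-1}(φ_A)` of the monodromy
  `φ_A = T_{a₁} ⋯ T_{a_k}` of a positive word `A` lie in the normal closure of the curve classes
  `[a₁], …, [a_k]` — geometrically, `π₁(∂X_A) → π₁(X_A)` is onto, so the seam relators die in
  `F_n ⧸ ⟪cls A⟫`.  Proof: every generator `x` has an on-the-nose inverse pair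
  `data x · data x⁻¹ = 1` (`SeamNG.mul_data_inv`), hence `g · g⁻¹ = 1` for words
  (`SeamNG.evalWord_mul_invWord`); the round twist `R = T_[a,b]` has `π = 1` and arc words in
  `{1, x_[a,b]^{±1}}`, so `R_*` is the identity modulo `⟪x_[a,b]⟫` (`SeamNG.aut_mk_eq`); therefore the
  twist `T_c = g R g⁻¹` of a curve `c = g(c_[a,b])` has `π = 1` and arc words
  `g_*(R_*(y) · R.u · y⁻¹) ∈ g_*⟪x_[a,b]⟫ ⊆ ⟪g_*(x_[a,b])⟫ = ⟪cls c⟫` (`SeamNG.twist_u_mem`), and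
  `(T_c)_*` preserves every normal subgroup containing `cls c`; induction over `A` with
  `u(T_c · M)ᵢ = (T_c)_*(u(M)ᵢ) · u(T_c)_{π_M i}`.
* `helper_seamTrivial_normallyGenerates`: if the seam group `⟨x₀ … x_{n-1} ∣ uᵢ(φ_A)⟩` is trivial
  then `⟪cls A⟫ ⊇ ⟪uᵢ(φ_A)⟫ = F_n`, i.e. `π₁(X_A) = 1`; and the same for any `B` with the same
  monodromy.  Uses nothing unproved.
-/

noncomputable section

open Literature.Topology.FourManifolds Literature.Topology.FourManifolds.PlanarWords

-- the prescribed namespace `Summit.<P>.<Sub>.…` duplicates `SmoothPoincare4` (P = Sub = SmoothPoincare4)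
set_option linter.dupNamespace false

namespace Summit.SmoothPoincare4.SmoothPoincare4.Theorems.PlanarAcyclicBisectionRigidity.Sketch

namespace SeamNG

open ArcData PGen FreeGroup WalkLow

variable {n : ℕ}

/-! ## Arc data with trivial permutation and arc words in a normal subgroup act trivially modulo it -/

/-- If `π_φ = 1` and every arc word `uᵢ(φ)` lies in the normal subgroup `N ⊴ F_n`, then the induced
automorphism `φ_* : xᵢ ↦ uᵢ xᵢ uᵢ⁻¹` is the identity on `F_n ⧸ N`. [folklore] -/
theorem aut_mk_eq (φ : ArcData n) (N : Subgroup (FreeGroup (Fin n))) [N.Normal] (hp : φ.perm = 1)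
    (hu : ∀ j, φ.u j ∈ N) (y : FreeGroup (Fin n)) :
    (QuotientGroup.mk' N) (φ.aut y) = QuotientGroup.mk' N y := by
  have h : (QuotientGroup.mk' N).comp φ.aut = QuotientGroup.mk' N :=
    FreeGroup.ext_hom _ _ fun j => by
      have hj : ((φ.u j : FreeGroup (Fin n)) : FreeGroup (Fin n) ⧸ N) = 1 :=
        (QuotientGroup.eq_one_iff _).2 (hu j)
      simp [aut_of, hp, hj]
  exact DFunLike.congr_fun h y

/-- Under the hypotheses of `aut_mk_eq`, `φ_*` preserves membership in `N` (both ways). [folklore] -/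
theorem aut_mem_iff (φ : ArcData n) (N : Subgroup (FreeGroup (Fin n))) [N.Normal] (hp : φ.perm = 1)
    (hu : ∀ j, φ.u j ∈ N) (y : FreeGroup (Fin n)) : φ.aut y ∈ N ↔ y ∈ N := by
  rw [← QuotientGroup.eq_one_iff, ← QuotientGroup.eq_one_iff (N := N) y]
  exact Eq.congr_left (aut_mk_eq φ N hp hu y)

/-- Under the hypotheses of `aut_mk_eq`, `φ_*(y) · y⁻¹ ∈ N` for every `y ∈ F_n`. [folklore] -/
theorem aut_mul_inv_mem (φ : ArcData n) (N : Subgroup (FreeGroup (Fin n))) [N.Normal]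
    (hp : φ.perm = 1) (hu : ∀ j, φ.u j ∈ N) (y : FreeGroup (Fin n)) : φ.aut y * y⁻¹ ∈ N := by
  rw [← div_eq_mul_inv, ← QuotientGroup.eq_iff_div_mem]
  exact aut_mk_eq φ N hp hu y

/-! ## Round twists: arc data, the block word is fixed, on-the-nose inverse pairs for all generators -/

/-- If `φ_*` conjugates every generator of a list by the same `v`, it conjugates their product by
`v`. [folklore] -/
theorem aut_prod_conj (φ : ArcData n) (v : FreeGroup (Fin n)) (L : List (Fin n))
    (hL : ∀ i ∈ L, φ.aut (of i) = v * of i * v⁻¹) :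
    φ.aut (L.map of).prod = v * (L.map of).prod * v⁻¹ := by
  induction L with
  | nil => simp
  | cons i L ih =>
    rw [List.map_cons, List.prod_cons, MonoidHom.map_mul, hL i (by simp),
      ih fun k hk => hL k (by simp [hk])]
    group

/-- A round twist does not permute the holes (definitional). [folklore] -/
theorem round_perm (a b : ℕ) (s : Bool) : (data n (round a b s)).perm = 1 := rfl

/-- The arc words of a round twist `T_[a,b]^{∓}` (definitional): `x_[a,b]^{∓}` on the holes
`a ≤ i ≤ b`, `1` elsewhere. [folklore] -/
theorem round_u (a b : ℕ) (s : Bool) (i : Fin n) : (data n (round a b s)).u i =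
    if a ≤ i.val ∧ i.val ≤ b then (if s then (blockWord n a b)⁻¹ else blockWord n a b) else 1 := rfl

/-- A round twist fixes the class `x_[a,b] = x_a ⋯ x_b` of its own curve: it conjugates each of
`x_a, …, x_b` by `x_[a,b]^{±1}`. [folklore] -/
theorem aut_round_blockWord (a b : ℕ) (s : Bool) :
    (data n (round a b s)).aut (blockWord n a b) = blockWord n a b := by
  set v : FreeGroup (Fin n) := if s then (blockWord n a b)⁻¹ else blockWord n a b with hv
  have key : (data n (round a b s)).aut (blockWord n a b) = v * blockWord n a b * v⁻¹ := by
    unfold blockWord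
    refine aut_prod_conj _ _ _ fun i hi => ?_
    have hi' : a ≤ i.val ∧ i.val ≤ b := by simpa using hi
    rw [aut_of, round_perm, round_u, if_pos hi', Equiv.Perm.one_apply]
  rw [key, hv]
  cases s <;> simp

/-- ON-THE-NOSE INVERSE PAIRS: `x · x⁻¹ = 1` as arc data for every generator `x` (half-twists:
`σⱼσⱼ⁻¹`, by the choice `u_{j+1}(σⱼ⁻¹) = x_{j+1}⁻¹`; round twists: `T_[a,b]` fixes `x_[a,b]`),
on any number of holes and without support hypothesis. [folklore] -/
theorem mul_data_inv (p : PGen) : mul (data n p) (data n p.inv) = one := by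
  cases p with
  | sigma j s =>
    simp only [PGen.inv, PGen.data]
    by_cases h : j + 1 < n
    · simp only [h, ↓reduceDIte]
      have hne : (⟨j, by omega⟩ : Fin n) ≠ ⟨j + 1, h⟩ := by simp
      refine ext' (by simp) fun i => ?_
      cases s
      · by_cases hi : i = ⟨j + 1, h⟩
        · subst hi; simp [aut_of, hne.symm]
        · have : ¬ (Equiv.swap (⟨j, by omega⟩ : Fin n) ⟨j + 1, h⟩ i = ⟨j, by omega⟩) := by
            rw [Equiv.swap_apply_eq_iff, Equiv.swap_apply_left]; exact hi
          simp [hi, this]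
      · by_cases hi : i = ⟨j, by omega⟩
        · subst hi; simp [aut_of, hne]
        · have : ¬ (Equiv.swap (⟨j, by omega⟩ : Fin n) ⟨j + 1, h⟩ i = ⟨j + 1, h⟩) := by
            rw [Equiv.swap_apply_eq_iff, Equiv.swap_apply_right]; exact hi
          simp [hi, this]
    · simp [h]
  | round a b s =>
    refine ext' (by simp [PGen.inv, round_perm]) fun i => ?_
    have hb := aut_round_blockWord (n := n) a b s
    simp only [PGen.inv]
    rw [mul_u, one_u, round_perm, Equiv.Perm.one_apply, round_u, round_u]
    by_cases hi : a ≤ i.val ∧ i.val ≤ b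
    · rw [if_pos hi, if_pos hi]
      cases s <;> simp [hb]
    · rw [if_neg hi, if_neg hi]; simp

/-- `g · g⁻¹ = 1` as arc data for every word `g` and its formal inverse, on any number of holes.
[folklore] -/
theorem evalWord_mul_invWord (g : List PGen) :
    mul (evalWord n g) (evalWord n (invWord g)) = one := by
  induction g with
  | nil => simp [evalWord_nil]
  | cons p g ih =>
    calc mul (evalWord n (p :: g)) (evalWord n (invWord (p :: g)))
        = mul (data n p) (mul (mul (evalWord n g) (evalWord n (invWord g))) (data n p.inv)) := by
          simp only [invWord_cons, evalWord_append, evalWord_cons, evalWord_nil, mul_one', mul_assoc']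
      _ = one := by rw [ih, one_mul', mul_data_inv]

/-! ## The positive twist `T_c = g · T_[a,b] · g⁻¹` of a curve `c = g(c_[a,b])` -/

/-- The positive twist word of `c = ⟨a, b, g⟩` evaluates to `g · T_[a,b] · g⁻¹`. [folklore] -/
theorem twist_eval (c : PlanarCurve) : evalWord n (c.twistWord true) =
    mul (evalWord n c.g) (mul (data n (round c.a c.b false)) (evalWord n (invWord c.g))) := by
  rw [PlanarCurve.twistWord, evalWord_append, evalWord_append, evalWord_cons, evalWord_nil, mul_one',
    mul_assoc', Bool.not_true]

/-- A positive Dehn twist does not permute the holes: `π(T_c) = π_g · π_{g⁻¹} = 1`. [folklore] -/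
theorem twist_perm (c : PlanarCurve) : (evalWord n (c.twistWord true)).perm = 1 := by
  rw [twist_eval, mul_perm, mul_perm, round_perm, one_mul, ← mul_perm, evalWord_mul_invWord, one_perm]

/-- The arc words of a round twist lie in the normal closure of its block word. [folklore] -/
theorem round_u_mem (a b : ℕ) (s : Bool) (i : Fin n) :
    (data n (round a b s)).u i ∈ Subgroup.normalClosure {blockWord n a b} := by
  have h : blockWord n a b ∈ Subgroup.normalClosure {blockWord n a b} :=
    Subgroup.subset_normalClosure (Set.mem_singleton _)
  rw [round_u]
  split_ifs
  · exact inv_mem h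
  · exact h
  · exact one_mem _

/-- THE KEY MEMBERSHIP: every arc word of the positive twist `T_c` lies in the normal closure of the
class `cls c = g_*(x_[a,b])`.  With `R = T_[a,b]`, `y = u(g⁻¹)ⱼ`, `k = π_{g⁻¹} j`:
`u(T_c)ⱼ = g_*(R_* y · u(R)_k) · u(g)_k = g_*(R_* y · u(R)_k · y⁻¹)` (as `g_*(y) · u(g)_k = u(g g⁻¹)ⱼ = 1`),
and `R_* y · y⁻¹`, `u(R)_k ∈ ⟪x_[a,b]⟫`, whose image under `g_*` lies in `⟪g_*(x_[a,b])⟫`. [folklore] -/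
theorem twist_u_mem (c : PlanarCurve) (j : Fin n) :
    (evalWord n (c.twistWord true)).u j ∈ Subgroup.normalClosure {c.cls n} := by
  rw [twist_eval]
  set Eg := evalWord n c.g with hEg
  set Ei := evalWord n (invWord c.g) with hEi
  set R := data n (round c.a c.b false) with hR
  have h1 : Eg.aut (Ei.u j) * Eg.u (Ei.perm j) = 1 := by
    have h := congrArg (fun φ : ArcData n => φ.u j) (evalWord_mul_invWord (n := n) c.g)
    simpa only [mul_u, one_u] using h
  have h2 : (mul Eg (mul R Ei)).u j = Eg.aut (R.aut (Ei.u j) * R.u (Ei.perm j) * (Ei.u j)⁻¹) := by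
    rw [mul_u, mul_u, mul_perm, hR, round_perm, one_mul, eq_inv_of_mul_eq_one_right h1]
    simp only [MonoidHom.map_mul, MonoidHom.map_inv]
  have h3 : R.aut (Ei.u j) * R.u (Ei.perm j) * (Ei.u j)⁻¹ ∈
      Subgroup.normalClosure {blockWord n c.a c.b} := by
    have e : R.aut (Ei.u j) * R.u (Ei.perm j) * (Ei.u j)⁻¹ =
        (R.aut (Ei.u j) * (Ei.u j)⁻¹) * (Ei.u j * R.u (Ei.perm j) * (Ei.u j)⁻¹) := by group
    rw [e]
    exact mul_mem (aut_mul_inv_mem R _ (round_perm _ _ _) (round_u_mem _ _ _) _)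
      ((Subgroup.normalClosure_normal).conj_mem _ (round_u_mem _ _ _ _) _)
  rw [h2]
  have h4 := Subgroup.map_normalClosure_le {blockWord n c.a c.b} Eg.aut ⟨_, h3, rfl⟩
  simpa only [Set.image_singleton, PlanarCurve.cls] using h4

/-- The monodromy of the empty positive word is the identity (definitional). [folklore] -/
theorem monodromy_positiveWord_nil : monodromy n (positiveWord []) = one := rfl

/-- The monodromy of `c :: A` is `T_c · φ_A` (first letter outermost). [folklore] -/
theorem monodromy_positiveWord_cons (c : PlanarCurve) (A : List PlanarCurve) :
    monodromy n (positiveWord (c :: A)) =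
      mul (evalWord n (c.twistWord true)) (monodromy n (positiveWord A)) := by
  simp [monodromy, positiveWord, Letter.twistWord, evalWord_append]

end SeamNG

open SeamNG WalkLow in
/-- **Helper 1 of line Sketch (v2.0) — the seam relators die in the block group.**  For every
positive word `A` on `n` holes, every arc word `uᵢ(φ_A)` of its monodromy `φ_A = T_{a₁} ⋯ T_{a_k}`
lies in the normal closure of the curve classes `cls a₁, …, cls a_k` (geometrically:
`π₁(∂X_A) → π₁(X_A)` is surjective, so the relators of the seam presentation
`⟨x₀ … x_{n−1} ∣ uᵢ(φ_A)⟩` are trivial in `π₁(X_A) = F_n ⧸ ⟪cls A⟫`).  Induction over `A` with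
`u(T_c · M)ᵢ = (T_c)_*(u(M)ᵢ) · u(T_c)_{π_M i}`: the arc words of `T_c` lie in `⟪cls c⟫`
(`SeamNG.twist_u_mem`), `π(T_c) = 1` (`SeamNG.twist_perm`), so `(T_c)_*` preserves every normal
subgroup containing `cls c` (`SeamNG.aut_mem_iff`). [folklore] -/
theorem helper_monodromyU_mem (n : ℕ) (A : List PlanarCurve) (i : Fin n) :
    (monodromy n (positiveWord A)).u i ∈ Subgroup.normalClosure {x | x ∈ A.map (PlanarCurve.cls n)} := by
  induction A generalizing i with
  | nil => rw [monodromy_positiveWord_nil, one_u]; exact one_mem _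
  | cons c A ih =>
    rw [monodromy_positiveWord_cons, mul_u]
    have hc : Subgroup.normalClosure {c.cls n} ≤
        Subgroup.normalClosure {x | x ∈ (c :: A).map (PlanarCurve.cls n)} :=
      Subgroup.normalClosure_mono (by simp)
    have hA : Subgroup.normalClosure {x | x ∈ A.map (PlanarCurve.cls n)} ≤
        Subgroup.normalClosure {x | x ∈ (c :: A).map (PlanarCurve.cls n)} :=
      Subgroup.normalClosure_mono fun x hx => List.mem_cons_of_mem _ hx
    exact mul_mem ((aut_mem_iff _ _ (twist_perm c) (fun j => hc (twist_u_mem c j)) _).2 (hA (ih i)))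
      (hc (twist_u_mem c _))

/-- **Helper 2 of line Sketch (v2.0) — a trivial seam group makes both blocks simply connected.**
If two positive words `A`, `B` on `n` holes have the same monodromy and the seam presentation
`⟨x₀ … x_{n−1} ∣ uᵢ(φ_A)⟩` presents the trivial group (`SeamTrivial n A`, i.e. `π₁(∂X_A) = 1`), then
the curve classes of `A` and of `B` each normally generate `F_n` (`π₁(X_A) = π₁(X_B) = 1`): by
`helper_monodromyU_mem`, `F_n = ⟪uᵢ(φ_A)⟫ ≤ ⟪cls A⟫`, and `uᵢ(φ_B) = uᵢ(φ_A)`. [folklore] -/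
theorem helper_seamTrivial_normallyGenerates (n : ℕ) (A B : List PlanarCurve)
    (hmon : monodromy n (positiveWord A) = monodromy n (positiveWord B)) (hs : SeamTrivial n A) :
    NormallyGenerates n A ∧ NormallyGenerates n B := by
  unfold SeamTrivial at hs
  rw [BalancedPresentation.presentsTrivialGroup_iff_normalClosure_eq_top] at hs
  refine ⟨?_, ?_⟩
  · unfold NormallyGenerates
    rw [eq_top_iff, ← hs]
    exact Subgroup.normalClosure_le_normal
      (Set.range_subset_iff.2 fun i => helper_monodromyU_mem n A i)
  · unfold NormallyGenerates
    rw [eq_top_iff, ← hs, hmon]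
    exact Subgroup.normalClosure_le_normal
      (Set.range_subset_iff.2 fun i => helper_monodromyU_mem n B i)

end Summit.SmoothPoincare4.SmoothPoincare4.Theorems.PlanarAcyclicBisectionRigidity.Sketch

end
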